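import Literature.Analysis.Convexity.AnisotropicIsoperimetricMollifier
import Mathlib.Analysis.Convex.Integral
import HarnessLib

/-!
# The anisotropic isoperimetric inequality, IIb: mollification does not increase the
# `K`-perimeter — admissible fields and the bound

Topic `Literature/Analysis/Convexity`; continuation of `AnisotropicIsoperimetricMollifier.lean`
(part IIa: the adjointness identity `∫ Du(x)[k(x)] dx = -∫_G div(ρ * k)` for `u = ρ * χ_G`).
Here: (i) the mollified selection `ρ * k` is an ADMISSIBLE field for the distributional
`K`-perimeter `P_K(G) = sup {∫_G div η : η ∈ C¹_c(ℝⁿ; ℝⁿ), η(x) ∈ K}` — it is `C¹`, compactly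
supported, and `K`-valued when `K` is closed convex and `ρ ≥ 0`, `∫ ρ = 1`
(`convolution_mem_of_forall_mem`, Jensen / `Convex.integral_mem`); (ii) a measurable maximiser
over a finite set `F` exists (first maximiser in an enumeration); (iii) hence
`∫ max_{z ∈ F} (-Du(x)[z]) dx ≤ P_K(G)` for every finite `F ⊆ K` containing `0`
(`lintegral_finsetSup_neg_fderiv_le_iSup`) — Evans–Gariepy's Thm 5.3 (ii) "mollification does
not increase the variation", in the anisotropic finite-net form consumed by the Wulff-inequality
assembly (`AnisotropicIsoperimetric.lean`), where `F` runs through `ε`-nets of `K` so that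
`max_F → h_K(-∇u)`, the `K`-total variation density.

All statements on `EuclideanSpace ℝ (Fin n)` with Lebesgue measure; the `K`-perimeter is written
out as the `iSup` (no definition introduced).

## References
* L. C. Evans, R. F. Gariepy, *Measure Theory and Fine Properties of Functions*, revised ed.
  (CRC 2015), §5.2.2 Thm 5.3 (ii). [`EvansGariepy2015`]
-/

noncomputable section

open Set Filter Function
open _root_.MeasureTheory _root_.MeasureTheory.Measure ContinuousLinearMap
open scoped ENNReal NNReal Topology Convolution InnerProductSpace

namespace Literature.Analysis.Convexity

open Literature.MathematicalPhysics.StatisticalMechanics (fieldDivergence)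

variable {n : ℕ}

/-- A bounded, a.e.-strongly measurable, compactly supported function is integrable. [folklore] -/
private theorem integrable_of_bound_of_hasCompactSupport' {F : Type*} [NormedAddCommGroup F]
    {k : EuclideanSpace ℝ (Fin n) → F} (hkm : AEStronglyMeasurable k volume) {C : ℝ}
    (hkC : ∀ x, ‖k x‖ ≤ C) (hck : HasCompactSupport k) : Integrable k volume := by
  rw [← integrableOn_iff_integrable_of_support_subset (subset_tsupport k)]
  exact IntegrableOn.of_bound hck.isCompact.measure_lt_top hkm.restrict C
    (Eventually.of_forall hkC)

/-! ### The mollified selection is an admissible field -/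

/-- A mollification `ρ * k` of a `K`-valued bounded measurable field by a probability kernel
`ρ ≥ 0`, `∫ ρ = 1`, takes values in `K` when `K` is closed and convex (an average of points of
`K`). [cite: EvansGariepy2015, §5.2.2 Thm 5.3 (proof of (ii): `|η_ε * φ| ≤ 1`)] -/
theorem convolution_mem_of_forall_mem {K : Set (EuclideanSpace ℝ (Fin n))} (hKc : Convex ℝ K)
    (hKcl : IsClosed K) {ρ : EuclideanSpace ℝ (Fin n) → ℝ} (hρc : Continuous ρ)
    (hcρ : HasCompactSupport ρ) (hρ0 : ∀ x, 0 ≤ ρ x) (hρ1 : ∫ x, ρ x = 1)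
    {k : EuclideanSpace ℝ (Fin n) → EuclideanSpace ℝ (Fin n)} (hkm : AEStronglyMeasurable k volume)
    {C : ℝ} (hkC : ∀ x, ‖k x‖ ≤ C) (hkK : ∀ x, k x ∈ K) (y : EuclideanSpace ℝ (Fin n)) :
    (ρ ⋆[lsmul ℝ ℝ, volume] k) y ∈ K := by
  have hρi : Integrable ρ volume := hρc.integrable_of_hasCompactSupport hcρ
  set μρ : Measure (EuclideanSpace ℝ (Fin n)) :=
    volume.withDensity fun t => ENNReal.ofReal (ρ t) with hμρ
  have hρm : Measurable fun t => ENNReal.ofReal (ρ t) :=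
    ENNReal.measurable_ofReal.comp hρc.measurable
  haveI : IsProbabilityMeasure μρ := by
    refine ⟨?_⟩
    rw [hμρ, withDensity_apply _ MeasurableSet.univ, Measure.restrict_univ,
      ← ofReal_integral_eq_lintegral_ofReal hρi (Eventually.of_forall hρ0), hρ1, ENNReal.ofReal_one]
  have key : ∫ t, k (y - t) ∂μρ = ∫ t, ρ t • k (y - t) := by
    rw [hμρ, integral_withDensity_eq_integral_toReal_smul hρm
      (Eventually.of_forall fun _ => ENNReal.ofReal_lt_top)]
    refine integral_congr_ae (Eventually.of_forall fun t => ?_)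
    dsimp only
    rw [ENNReal.toReal_ofReal (hρ0 t)]
  have hkym : AEStronglyMeasurable (fun t => k (y - t)) volume :=
    hkm.comp_quasiMeasurePreserving (quasiMeasurePreserving_sub_left volume y)
  rw [convolution_def]
  simp only [lsmul_apply]
  rw [← key]
  refine hKc.integral_mem hKcl (Eventually.of_forall fun t => hkK _) ?_
  exact Integrable.of_bound (hkym.mono_ac (withDensity_absolutelyContinuous _ _)) C
    (Eventually.of_forall fun t => hkC _)

/-! ### Measurable argmax over a finite set -/

/-- **Measurable selection of a maximiser over a finite set**: for finitely many measurable
functions `x ↦ φ x z` (`z ∈ F`) there is a measurable `F`-valued `s` with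
`φ x z ≤ φ x (s x)` for all `z ∈ F` (first maximiser in an enumeration). [folklore] -/
private theorem exists_measurable_argmax {β : Type*} [MeasurableSpace β]
    [MeasurableSingletonClass β] (F : Finset β) (hF : F.Nonempty)
    (φ : EuclideanSpace ℝ (Fin n) → β → ℝ) (hφ : ∀ z, Measurable fun x => φ x z) :
    ∃ s : EuclideanSpace ℝ (Fin n) → β, Measurable s ∧ (∀ x, s x ∈ F) ∧
      (Measurable fun x => φ x (s x)) ∧ ∀ x, ∀ z ∈ F, φ x z ≤ φ x (s x) := by
  classical
  induction F using Finset.induction_on with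
  | empty => exact absurd hF Finset.not_nonempty_empty
  | insert a F' ha ih =>
    rcases F'.eq_empty_or_nonempty with hF' | hF'
    · refine ⟨fun _ => a, measurable_const, fun _ => Finset.mem_insert_self _ _, hφ a, ?_⟩
      intro x z hz
      rw [hF', Finset.insert_empty, Finset.mem_singleton] at hz
      rw [hz]
    · obtain ⟨s', hs'm, hs'F, hφs', hs'max⟩ := ih hF'
      refine ⟨fun x => if φ x (s' x) ≤ φ x a then a else s' x, ?_, ?_, ?_, ?_⟩
      · exact Measurable.ite (measurableSet_le hφs' (hφ a)) measurable_const hs'm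
      · intro x
        by_cases h : φ x (s' x) ≤ φ x a
        · simp only [h, if_true]; exact Finset.mem_insert_self _ _
        · simp only [h, if_false]; exact Finset.mem_insert_of_mem (hs'F x)
      · have : (fun x => φ x (if φ x (s' x) ≤ φ x a then a else s' x)) =
            fun x => if φ x (s' x) ≤ φ x a then φ x a else φ x (s' x) := by
          funext x; split_ifs <;> rfl
        rw [this]
        exact Measurable.ite (measurableSet_le hφs' (hφ a)) (hφ a) hφs'
      · intro x z hz
        rcases Finset.mem_insert.1 hz with rfl | hz'
        · by_cases h : φ x (s' x) ≤ φ x z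
          · simp only [h, if_true]; exact le_rfl
          · simp only [h, if_false]; exact (lt_of_not_ge h).le
        · by_cases h : φ x (s' x) ≤ φ x a
          · simp only [h, if_true]; exact (hs'max x z hz').trans h
          · simp only [h, if_false]; exact hs'max x z hz'

/-! ### The bound: finite maxima of `-Du` integrate to at most the `K`-perimeter -/

/-- **Mollification does not increase the `K`-variation (finite-net form).** Let `K ⊆ ℝⁿ` be
closed and convex, `F ⊆ K` finite with `0 ∈ F`, `ρ ∈ C¹_c` an even probability kernel, `G`
measurable of finite volume and `u = ρ * χ_G`. Then
`∫ max_{z ∈ F} (-Du(x)[z]) dx ≤ P_K(G) = sup {∫_G div η : η ∈ C¹_c(ℝⁿ; K)}`: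
by the adjointness identity the truncated maximiser field `k_R = 𝟙_{B_R} · argmax` gives
`∫_{B_R} max_F (-Du[z]) = ∫_G div(ρ * k_R) ≤ P_K(G)`, and `R → ∞`.
[cite: EvansGariepy2015, §5.2.2 Thm 5.3 (ii)] -/
theorem lintegral_finsetSup_neg_fderiv_le_iSup {K : Set (EuclideanSpace ℝ (Fin n))}
    (hKc : Convex ℝ K) (hKcl : IsClosed K) {F : Finset (EuclideanSpace ℝ (Fin n))}
    (hFK : ∀ z ∈ F, z ∈ K) (h0F : (0 : EuclideanSpace ℝ (Fin n)) ∈ F)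
    {ρ : EuclideanSpace ℝ (Fin n) → ℝ} (hρ : ContDiff ℝ 1 ρ) (hcρ : HasCompactSupport ρ)
    (hρe : ∀ x, ρ (-x) = ρ x) (hρ0 : ∀ x, 0 ≤ ρ x) (hρ1 : ∫ x, ρ x = 1)
    {G : Set (EuclideanSpace ℝ (Fin n))} (hG : MeasurableSet G) (hGfin : volume G < ⊤) :
    ∫⁻ x, ENNReal.ofReal (F.sup' ⟨0, h0F⟩ fun z =>
        -(fderiv ℝ (ρ ⋆[lsmul ℝ ℝ, volume] (G.indicator fun _ => (1 : ℝ))) x z)) ≤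
      ⨆ (φ : EuclideanSpace ℝ (Fin n) → EuclideanSpace ℝ (Fin n))
        (_ : ContDiff ℝ 1 φ ∧ HasCompactSupport φ ∧ ∀ x, φ x ∈ K),
        ENNReal.ofReal (∫ x in G, fieldDivergence φ x) := by
  set χ : EuclideanSpace ℝ (Fin n) → ℝ := G.indicator fun _ => (1 : ℝ) with hχ_def
  have hχi : Integrable χ volume :=
    (integrable_indicator_iff hG).2 (integrableOn_const hGfin.ne)
  set u := ρ ⋆[lsmul ℝ ℝ, volume] χ with hu_def
  have hu : ContDiff ℝ 1 u := hcρ.contDiff_convolution_left _ hρ hχi.locallyIntegrable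
  have hDu : Continuous (fderiv ℝ u) := hu.continuous_fderiv one_ne_zero
  have hDuz : ∀ z, Continuous fun x => -(fderiv ℝ u x z) := fun z =>
    (hDu.clm_apply continuous_const).neg
  set M : EuclideanSpace ℝ (Fin n) → ℝ := fun x => F.sup' ⟨0, h0F⟩ fun z => -(fderiv ℝ u x z)
    with hM_def
  have hMc : Continuous M := Continuous.finset_sup'_apply _ fun z _ => hDuz z
  have hM0 : ∀ x, 0 ≤ M x := fun x => by
    have h := Finset.le_sup' (fun z => -(fderiv ℝ u x z)) h0F
    rwa [map_zero, neg_zero] at h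
  -- a measurable maximiser
  obtain ⟨s, hsm, hsF, -, hsmax⟩ := exists_measurable_argmax F ⟨0, h0F⟩
    (fun x z => -(fderiv ℝ u x z)) fun z => (hDuz z).measurable
  have hMs : ∀ x, M x = -(fderiv ℝ u x (s x)) := fun x =>
    le_antisymm (Finset.sup'_le _ _ (hsmax x)) (Finset.le_sup' (fun z => -(fderiv ℝ u x z)) (hsF x))
  -- a bound for the values of the selection
  set CF : ℝ := F.sup' ⟨0, h0F⟩ fun z => ‖z‖ with hCF
  have hCF0 : 0 ≤ CF := by
    have h := Finset.le_sup' (fun z : EuclideanSpace ℝ (Fin n) => ‖z‖) h0F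
    rwa [norm_zero] at h
  -- truncated selections and the identity on balls
  have key : ∀ R : ℕ, ∫⁻ x in Metric.closedBall (0 : EuclideanSpace ℝ (Fin n)) R,
      ENNReal.ofReal (M x) ≤
      ⨆ (φ : EuclideanSpace ℝ (Fin n) → EuclideanSpace ℝ (Fin n))
        (_ : ContDiff ℝ 1 φ ∧ HasCompactSupport φ ∧ ∀ x, φ x ∈ K),
        ENNReal.ofReal (∫ x in G, fieldDivergence φ x) := by
    intro R
    set B := Metric.closedBall (0 : EuclideanSpace ℝ (Fin n)) R with hB
    have hBm : MeasurableSet B := Metric.isClosed_closedBall.measurableSet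
    set kR : EuclideanSpace ℝ (Fin n) → EuclideanSpace ℝ (Fin n) := B.indicator s with hkR
    have hkRm : Measurable kR := hsm.indicator hBm
    have hkRK : ∀ x, kR x ∈ K := fun x => by
      by_cases hx : x ∈ B
      · rw [hkR, Set.indicator_of_mem hx]; exact hFK _ (hsF x)
      · rw [hkR, Set.indicator_of_notMem hx]; exact hFK _ h0F
    have hkRC : ∀ x, ‖kR x‖ ≤ CF := fun x => by
      by_cases hx : x ∈ B
      · rw [hkR, Set.indicator_of_mem hx]
        exact Finset.le_sup' (fun z : EuclideanSpace ℝ (Fin n) => ‖z‖) (hsF x)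
      · rw [hkR, Set.indicator_of_notMem hx, norm_zero]; exact hCF0
    have hkRs : HasCompactSupport kR :=
      HasCompactSupport.intro (isCompact_closedBall _ _) fun x hx =>
        Set.indicator_of_notMem hx _
    have hid := integral_fderiv_convolution_indicator_apply hρ hcρ hρe hG hGfin
      hkRm.aestronglyMeasurable hkRC hkRs
    have hpt : ∀ x, fderiv ℝ u x (kR x) = -B.indicator M x := fun x => by
      by_cases hx : x ∈ B
      · rw [hkR, Set.indicator_of_mem hx, Set.indicator_of_mem hx, hMs, neg_neg]
      · rw [hkR, Set.indicator_of_notMem hx, Set.indicator_of_notMem hx, map_zero, neg_zero]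
    have hI : ∫ x in B, M x = ∫ y in G, fieldDivergence (ρ ⋆[lsmul ℝ ℝ, volume] kR) y := by
      rw [← integral_indicator hBm]
      have h2 : ∫ x, B.indicator M x = -∫ x, fderiv ℝ u x (kR x) := by
        rw [← integral_neg]
        exact integral_congr_ae (Eventually.of_forall fun x => by
          show B.indicator M x = -(fderiv ℝ u x (kR x)); rw [hpt, neg_neg])
      rw [h2, hu_def, hχ_def, hid, neg_neg]
    have hMi : IntegrableOn M B volume :=
      hMc.continuousOn.integrableOn_compact (isCompact_closedBall _ _)
    rw [← ofReal_integral_eq_lintegral_ofReal hMi (Eventually.of_forall hM0), hI]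
    refine le_iSup₂_of_le (ρ ⋆[lsmul ℝ ℝ, volume] kR) ⟨?_, ?_, ?_⟩ le_rfl
    · exact hcρ.contDiff_convolution_left _ hρ
        (integrable_of_bound_of_hasCompactSupport' hkRm.aestronglyMeasurable hkRC
          hkRs).locallyIntegrable
    · exact hcρ.convolution _ hkRs
    · exact convolution_mem_of_forall_mem hKc hKcl hρ.continuous hcρ hρ0 hρ1
        hkRm.aestronglyMeasurable hkRC hkRK
  -- exhaust `ℝⁿ` by balls
  have hmono : Monotone fun R : ℕ =>
      (Metric.closedBall (0 : EuclideanSpace ℝ (Fin n)) R).indicator fun x =>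
        ENNReal.ofReal (M x) := by
    intro R R' hRR'
    exact Set.indicator_le_indicator_of_subset
      (Metric.closedBall_subset_closedBall (by exact_mod_cast hRR')) fun _ => zero_le
  have hsup : (fun x => ENNReal.ofReal (M x)) = fun x => ⨆ R : ℕ,
      (Metric.closedBall (0 : EuclideanSpace ℝ (Fin n)) R).indicator
        (fun x => ENNReal.ofReal (M x)) x := by
    funext x
    apply le_antisymm
    · obtain ⟨R, hR⟩ := exists_nat_ge ‖x‖
      refine le_iSup_of_le R ?_
      rw [Set.indicator_of_mem (by simpa using hR)]
    · exact iSup_le fun R => Set.indicator_le_self _ _ x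
  rw [hsup, lintegral_iSup (fun R => hMc.measurable.ennreal_ofReal.indicator
    Metric.isClosed_closedBall.measurableSet) hmono]
  refine iSup_le fun R => ?_
  rw [lintegral_indicator Metric.isClosed_closedBall.measurableSet]
  exact key R
end Literature.Analysis.Convexity

end
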